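import Mathlib
import HarnessLib
import Summits.ValiantsHypothesis.ValiantsHypothesis.Theses.MonotoneRestoration
import Literature.Computability.AlgebraicComplexity.ArithCircuit
import Literature.Computability.AlgebraicComplexity.ArithCircuitProofs
import Literature.Computability.AlgebraicComplexity.MonotoneStructure
import Literature.Computability.AlgebraicComplexity.PermanentIrreducible
import Literature.ModelTheory.FiniteModelTheory.CkEquiv
import Summits.ValiantsHypothesis.ValiantsHypothesis.Theorems.MonotoneRestorationMonotoneRestorationQPCosetCount
import Summits.ValiantsHypothesis.ValiantsHypothesis.Theorems.MonotoneRestorationMonotoneRestorationQPSymmetricLB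
import Summits.ValiantsHypothesis.ValiantsHypothesis.Theorems.MonotoneRestorationMonotoneRestorationQPSupportSymmetrisation
import Summits.ValiantsHypothesis.ValiantsHypothesis.Theorems.MonotoneRestorationMonotoneRestorationQPSparseRegime
import Summits.ValiantsHypothesis.ValiantsHypothesis.Theorems.MonotoneRestorationMonotoneRestorationQPBeta
import Literature.Computability.AlgebraicComplexity.SymmetricArithCircuit
import Literature.Computability.AlgebraicComplexity.DawarWilsenach2025Proofs
import Literature.GroupTheory.PermutationGroups.SmallIndexSubgroups
import Summits.ValiantsHypothesis.ValiantsHypothesis.Theorems.MonotoneRestorationQP.Negative.LoadBearing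
import Summits.ValiantsHypothesis.ValiantsHypothesis.Theorems.MonotoneRestorationMonotoneRestorationQPPermSupportCount

/-! # TTRL-lite variant V20107 of `MonotoneRestorationQP` / `stub_gateSupport` (stmt-ValiantsHypothesis-15886)

Machine-generated helper (proved); move `small_case`, op `llm`: decidable certificate of the room-2 case of the
intersection lemma at `n = 4`, `X = {0}`, `X' = {1}`: with `s = (1 2 3) = swap 1 2 * swap 2 3` and
`t = (0 2 3) = swap 0 2 * swap 2 3`, every even permutation of `Fin 4` lies in `⟨s⟩·⟨t⟩·⟨s⟩·⟨t⟩`, i.e.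
`A₄ = S·T·S·T`.  See docs/architecture/ttrl-lite.md. -/

namespace Summit.ValiantsHypothesis.ValiantsHypothesis.Theorems

open Summit.ValiantsHypothesis.ValiantsHypothesis.Theses.MonotoneRestoration
open Literature.Computability.AlgebraicComplexity

/-- TTRL-lite variant V20107 (small_case `llm`) of `stub_gateSupport` (stmt-ValiantsHypothesis-15886):
every even permutation `ρ` of `Fin 4` is of the form `s ^ i * t ^ j * s ^ k * t ^ l` with `i j k l < 3`,
where `s = swap 1 2 * swap 2 3 = (1 2 3)` and `t = swap 0 2 * swap 2 3 = (0 2 3)`; i.e. the two point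
stabilisers `Alt_({0}) = ⟨s⟩` and `Alt_({1}) = ⟨t⟩` generate `A₄`, indeed `A₄ = ⟨s⟩⟨t⟩⟨s⟩⟨t⟩`.
Finite, decidable statement; closed by kernel decision. -/
theorem stub_gateSupport_var20107 :
    ∀ ρ : Equiv.Perm (Fin 4), Equiv.Perm.sign ρ = 1 → ∃ i j k l : Fin 3,
      ρ = (Equiv.swap (1 : Fin 4) 2 * Equiv.swap 2 3) ^ (i : ℕ) * (Equiv.swap (0 : Fin 4) 2 * Equiv.swap 2 3) ^ (j : ℕ)
        * (Equiv.swap (1 : Fin 4) 2 * Equiv.swap 2 3) ^ (k : ℕ) * (Equiv.swap (0 : Fin 4) 2 * Equiv.swap 2 3) ^ (l : ℕ) := by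
  decide +kernel

end Summit.ValiantsHypothesis.ValiantsHypothesis.Theorems
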